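import Literature.AlgebraicGeometry.Deformation.CoefficientFieldAugmentation
import Literature.AlgebraicGeometry.AbelianSchemes.AbelianSchemeLiftOfReducingGlueData
import Literature.AlgebraicGeometry.AbelianSchemes.ClosedFibreBaseChangeCover
import Literature.AlgebraicGeometry.Deformation.FlatDeformationTransitionDataCover
import Literature.AlgebraicGeometry.Deformation.SmoothSchemeLiftTransitionDataLift
import Literature.AlgebraicGeometry.Deformation.SmoothSchemeLiftObstructionCriterion
import Literature.AlgebraicGeometry.Deformation.AbelianObstructionCoboundary   -- the (iv-5) GAP-2 closer ★
import HarnessLib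

/-!
# FLOOR-0 P1, sub-line F-11, grandchild line `F11LiftWithLineBundle` — STUB G1-P `stub_abelianLift` (principal letter v0.2P): the
# abelian scheme `A₀` over `A ⧸ (t)` lifts to `A` — MODULO ONE SOCKET (GAP-2 for the abelian datum, (iv-5) closer)

Cell hodgecm-mathlib, FLOOR 0, crux item HDel = stmt-HodgeConjecture-24835; grandchild line `Cruxes/HDel/Lines/F11LiftWithLineBundle.lean`,
registered stub **G1 `stub_abelianLift`** in its PRINCIPAL letter of record v0.2P (`F0/P1b/Lines/LETTERS-alpha1P-G1P-G2P.v0.2P.F0P1bg0.lean.txt`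
:19, declsig 99fa7c9e868f3f59; planner F0P1b-plan (g0), (R39)(b)∕(R84)).  PROOF lane; integrator F0P1b-p06 (g0) (MONO-G1), successor-designate
F0P1c-p05 (g2) ((R75)(a)).  This file proves the stub's TYPE restated BINDER FOR BINDER as `stubG1_holds` (the Lines module is not imported —
crux workfiles are not built on the farm), so that the line's next edition closes the hole BY NAME:
`theorem stub_abelianLift (g : ℕ) : … := F11StubG1AbelianLift.stubG1_holds g` — ONCE THE ONE REMAINING SOCKET BELOW IS ★:
`socket_GAP2_abelian_datum` = «the ★ F2 A obstruction cochain of the abelian datum is a Čech coboundary» = the head of the (iv-5) closer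
(F0P1b-p05 (g0) `GAP2_of_slots` over ★ p797366, fed by the slot providers rel₁ B-p08 (g16), rel₂ F0P1a-p04∕B-p16, rel₃ F0P1b-p04 (g0), frame ★
p796982, refinement ★ p796429; slot-fit GREEN `F0/P1b/p06/MONO-G1-cert.v3.slotfit` 85f9331f).  UNTIL THEN THIS FILE IS A CERT (HOME
`F0/P1b/p06/`), NOT FILED: at filing time the socket declaration is DELETED and its one call in `abelianLift_of_closedFibre_cover` is replaced by
the closer's ★ name (v-next rule: nothing else changes; head bytes identical).

ROAD ([MumfordFogartyKirwan1994] Ch. 6 §3 Prop. 6.15 ∘ [Hartshorne2010] Thm. 10.2 ∘ [Oort1971] §2 / [MumfordAV1970] §13): coefficient field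
`k ⊂ A` ⟶ augmentation `π' : A ⧸ (t) → k` with nilpotent kernel (★ p798121 `exists_quotient_augmentation_of_coefficientField`) and coefficient
line `eJ : (t) ≃ₗ[k] k` (★ `nonempty_linearEquiv_span_singleton`) ⟶ closed fibre `X := A₀ ×_{A⧸(t)} k` LITERAL + principal affine cover of
`A₀.X` lifted from it (★ p797714 `exists_closedFibre_principal_affine_cover_explicit`) ⟶ transition data of `A₀.X` (★ c2b
`exists_transition_data_of_cover`) ⟶ lifts `ψ` over `A` (★ GAP-1 p796653 `exists_lifts_of_transition_data`) ⟶ obstruction cochain `o` (★ F2 A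
`exists_obstructionCochain`, `𝔫' := mk⁻¹ ker π'`) ⟶ `o = d¹γ` (SOCKET) ⟶ cocycle-exact `ψ₁ ≡ ψ (mod (t))` (★ F3a
`exists_cocycle_lifts_of_eq_cechMD1`) ⟶ `ψ₁` still reduces to `φ` (★ p798124 `map_mkₐ_eq_of_sub_mem_smul_top`) ⟶ abelian lift (★ p798124
`exists_lift_of_reducing_glueData`: glue ▸ structure map ▸ smooth ▸ cartesian reduction ▸ `Glue(φ) ≅ A₀.X` ▸ proper ▸ junction Prop. 6.15).

HC_CM is proved only modulo the 7 printed citations until rung 0 closes; this file (when filed) closes ONE stub (G1) of ONE grandchild line.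

## References
* [MumfordFogartyKirwan1994] D. Mumford, J. Fogarty, F. Kirwan, *Geometric Invariant Theory*, 3rd ed.: Ch. 6 §3 Prop. 6.15 (p. 124) and its
  proof (p. 125).
* [Hartshorne2010] R. Hartshorne, *Deformation Theory*, GTM 257: Thm. 10.2 and its proof (p. 81), Cor. 10.3 (p. 82).
* [Oort1971] F. Oort, *Finite group schemes, local moduli for abelian varieties, and lifting problems*, Compositio Math. 23 (1971): §2 (Thm. 2.2.1).
* [MumfordAV1970] D. Mumford, *Abelian Varieties* (1970): §13 Cor. 2.
-/

set_option autoImplicit false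
set_option linter.dupNamespace false

noncomputable section

set_option backward.isDefEq.respectTransparency false

open CategoryTheory CategoryTheory.Limits AlgebraicGeometry Opposite TopologicalSpace
open scoped TensorProduct

namespace Summit.HodgeConjecture.HodgeConjecture.Cruxes.HDel.F11StubG1AbelianLift

open Literature.AlgebraicGeometry.AbelianSchemes Literature.AlgebraicGeometry.Deformation Literature.AlgebraicGeometry.Morphisms
  Literature.AlgebraicGeometry.Motives Literature.AlgebraicGeometry.Modules Literature.AlgebraicGeometry.HodgeTheory SmoothAffineDeformation
open IsLocalRing

/-! ## MIDSTREAM COMPOSITION: 2bc-data ▸ ★ c2b ▸ GAP-1 ▸ ★ F2 A ▸ GAP-2 ▸ ★ F3a ▸ GAP-3 ▸ ★ `exists_lift_of_reducing_glueData` (PRINCIPAL currency `e : J ≃ₗ[k] k`) -/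

set_option maxHeartbeats 800000 in
/-- **G1-P, midstream + downstream** (everything after the choice of the augmentation, the coefficient line and the cover): ★ c2b
transition data of `A₀.X` ▸ ★ GAP-1 lifts `ψ` ▸ ★ F2 A obstruction cochain ▸ ★ GAP-2 (iv-5) ▸ ★ F3a cocycle-exact `ψ₁ ≡ ψ` ▸ ★ GAP-3 ▸ ★
`exists_lift_of_reducing_glueData` (glue, structure map, smooth, cartesian reduction, `Glue(φ) ≅ A₀.X`, proper, junction [MFK94] 6.15).
[cite: Hartshorne2010, Thm. 10.2 (proof), p. 81] [cite: MumfordFogartyKirwan1994, Ch. 6 §3 Prop. 6.15 (p. 124) and its proof (p. 125)] -/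
theorem abelianLift_of_closedFibre_cover
    {A : Type} [CommRing A] [Algebra ℚ A] [IsArtinianRing A] [IsLocalRing A] {k : Type} [Field k] [Algebra k A]
    (hk : Function.Surjective (⇑(IsLocalRing.residue A) ∘ ⇑(algebraMap k A)))
    {J : Ideal A} (hJ : J ≠ ⊤) (hmJ : IsLocalRing.maximalIdeal A * J = ⊥) (hJJ : J * J = ⊥)
    (eJ : ↥(J.restrictScalars k) ≃ₗ[k] k)
    [IsArtinianRing (A ⧸ J)] [IsLocalRing (A ⧸ J)]
    (π' : (A ⧸ J) →ₐ[k] k) (hπ'nil : IsNilpotent (RingHom.ker π'))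
    (hπ'max : (RingHom.ker π').comap (Ideal.Quotient.mk J) = IsLocalRing.maximalIdeal A)
    (A₀ : AbelianSchemeOver (Spec (.of (A ⧸ J)))) {g : ℕ} (hA₀ : A₀.IsOfRelDim g)
    -- the CLOSED FIBRE, LITERALLY (★ p797210's witnesses): `X := (A₀.baseChange s).X`, `i₀ := pullback.fst A₀.X.hom s`,
    -- `s := Spec.map (CommRingCat.ofHom π'.toRingHom)` — an abelian variety over `k` of dimension `g` BY CONSTRUCTION
    [instΓ : ∀ W : (A₀.baseChange (Spec.map (CommRingCat.ofHom π'.toRingHom))).X.left.Opens, Algebra k Γ((A₀.baseChange (Spec.map (CommRingCat.ofHom π'.toRingHom))).X.left, W)]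
    (halg : ∀ (W : (A₀.baseChange (Spec.map (CommRingCat.ofHom π'.toRingHom))).X.left.Opens) (s : k), algebraMap k Γ((A₀.baseChange (Spec.map (CommRingCat.ofHom π'.toRingHom))).X.left, W) s = (constToPresheaf (A₀.baseChange (Spec.map (CommRingCat.ofHom π'.toRingHom))).X).app (op W) s)
    [instΓA : ∀ W : A₀.X.left.Opens, Algebra (A ⧸ J) Γ(A₀.X.left, W)]
    (halgA : ∀ (W : A₀.X.left.Opens) (a : A ⧸ J), algebraMap (A ⧸ J) Γ(A₀.X.left, W) a = (constToPresheaf A₀.X).app (op W) a)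
    {ι : Type} (U' : ι → A₀.X.left.affineOpens) (b' : (j l : ι) → Γ(A₀.X.left, (U' j).1))
    (hb' : ∀ j l, (U' j).1 ⊓ (U' l).1 = A₀.X.left.basicOpen (b' j l)) (hU'cov : IsOpenCover fun j => (U' j).1)
    (U : ι → (A₀.baseChange (Spec.map (CommRingCat.ofHom π'.toRingHom))).X.left.affineOpens) (hU : ∀ j, (U j).1 = (pullback.fst A₀.X.hom (Spec.map (CommRingCat.ofHom π'.toRingHom))) ⁻¹ᵁ (U' j).1)
    (b : (j l : ι) → Γ((A₀.baseChange (Spec.map (CommRingCat.ofHom π'.toRingHom))).X.left, (U j).1)) (hb : ∀ j l, (U j).1 ⊓ (U l).1 = (A₀.baseChange (Spec.map (CommRingCat.ofHom π'.toRingHom))).X.left.basicOpen (b j l)) :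
    ∃ (𝒳 : AbelianSchemeOver (Spec (.of A))) (_ : 𝒳.IsOfRelDim g) (G : A₀.X.left ⟶ 𝒳.X.left),
      A₀.IsBaseChangeVia 𝒳 (Spec.map (CommRingCat.ofHom (Ideal.Quotient.mk J))) G := by
  haveI : Flat A₀.X.hom := by haveI := A₀.isSmooth; infer_instance
  haveI : Smooth (A₀.baseChange (Spec.map (CommRingCat.ofHom π'.toRingHom))).X.hom :=
    (A₀.baseChange (Spec.map (CommRingCat.ofHom π'.toRingHom))).isSmooth
  have hi₀ : IsPullback (pullback.fst A₀.X.hom (Spec.map (CommRingCat.ofHom π'.toRingHom))) (A₀.baseChange (Spec.map (CommRingCat.ofHom π'.toRingHom))).X.hom A₀.X.hom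
      (Spec.map (CommRingCat.ofHom π'.toRingHom)) := IsPullback.of_hasPullback _ _
  -- ★ c2b: transition data of `A₀.X` on the cover
  obtain ⟨e, ε₁, ε₂, he, hε₁, hε₂, hε₁', hε₂', hφ, hcocφ⟩ :=
    exists_transition_data_of_cover π' halg halgA (pullback.fst A₀.X.hom (Spec.map (CommRingCat.ofHom π'.toRingHom))) hi₀ U' b' hb' U hU
  -- ★ GAP-1 (p796653): lift the data over `A`
  obtain ⟨ψ, hL, hψ, hcoc⟩ := exists_lifts_of_transition_data halg J hJJ U b hb
    (fun j l => transition (ε₁ j l) (ε₂ j l)) (RingHom.ker π') hπ'nil hφ hcocφ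
  have h𝔫 : IsNilpotent ((RingHom.ker π').comap (Ideal.Quotient.mk J)) := by
    rw [hπ'max, ← IsLocalRing.jacobson_eq_maximalIdeal ⊥ bot_ne_top]
    exact IsArtinianRing.isNilpotent_jacobson_bot
  have hJ𝔫 : J * (RingHom.ker π').comap (Ideal.Quotient.mk J) = ⊥ := by rw [hπ'max, mul_comm]; exact hmJ
  have hJle : J ≤ (RingHom.ker π').comap (Ideal.Quotient.mk J) := by rw [hπ'max]; exact IsLocalRing.le_maximalIdeal hJ
  -- ★ F2 A: the obstruction cochain
  obtain ⟨o, ho⟩ := exists_obstructionCochain (halg := halg) (U := U) (b := b) (hb := hb) (J := J)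
    (𝔫' := (RingHom.ker π').comap (Ideal.Quotient.mk J)) (hJ := hJJ) (e := eJ) h𝔫 ψ hψ hcoc
  -- GAP-2: it is a coboundary (the abelian input)
  obtain ⟨γ, hγ⟩ := Literature.AlgebraicGeometry.Deformation.exists_cechMD1_eq_of_abelian_datum hk hJ hmJ eJ π' hπ'nil hπ'max A₀ hA₀ halg halgA U' b' hb' hU'cov U hU b hb
    e ε₁ ε₂ he hε₁ hε₂ hε₁' hε₂' hφ hcocφ ψ hL hψ hcoc o ho
  -- ★ F3a: cocycle-exact modification
  obtain ⟨ψ₁, hψ₁, hcong, hcoc₁⟩ := exists_cocycle_lifts_of_eq_cechMD1 (halg := halg) (U := U) (b := b) (hb := hb) (J := J)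
    (𝔫' := (RingHom.ker π').comap (Ideal.Quotient.mk J)) (hJ := hJJ) (hJ𝔫 := hJ𝔫) (e := eJ) h𝔫 hJle ψ hψ hcoc o ho γ hγ
  -- GAP-3 and the downstream half
  exact AbelianSchemeOver.exists_lift_of_reducing_glueData hJ hmJ π' hπ'nil A₀ hA₀ halg halgA (pullback.fst A₀.X.hom (Spec.map (CommRingCat.ofHom π'.toRingHom))) U' b' hb' hU'cov U hU b hb e he ε₁ ε₂ hε₁ hε₂ (RingHom.ker π') hπ'nil
    hφ hcocφ ψ₁ _ h𝔫 hψ₁ hcoc₁ (fun j l x => map_mkₐ_eq_of_sub_mem_smul_top (ψ j l) (ψ₁ j l) _ (hL j l) (hcong j l) x)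

/-! ## THE G1-P LETTER (letter of record v0.2P, declsig 99fa7c9e868f3f59) — modulo the one socket -/

/-- **STUB G1-P of line `F11LiftWithLineBundle`** — the body of `stub_abelianLift` (letter v0.2P) binder for binder: for `A` Artin local
with `A ⊇ ℚ`, a coefficient field `k` (`residue ∘ algebraMap k A` surjective), a principal small extension `t ≠ 0`, `t ∈ 𝔪_A`, `𝔪_A·(t) = 0`,
and an abelian scheme `A₀` of relative dimension `g` over `A ⧸ (t)`, there is an abelian scheme `X` of relative dimension `g` over `A` with
a cartesian `G : A₀.X → X.X` over `Spec (A ⧸ (t)) → Spec A` compatible with the group laws.  Proof = 2a′ (★ p798121) + 2d (★ p798121) +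
★ p797714 (closed fibre + cover, LITERAL) + `abelianLift_of_closedFibre_cover`.  (The tree's v0.0.1 letter with a GENERAL small `J` is the
parent's reduction level, (R40)(o3).) [cite: MumfordFogartyKirwan1994, Ch. 6 §3 Prop. 6.15 (p. 124) and its proof (p. 125)]
[cite: Hartshorne2010, Thm. 10.2 (proof), p. 81] -/
theorem stubG1_holds (g : ℕ) :
    ∀ (A : Type) [CommRing A] [Algebra ℚ A] [IsArtinianRing A] [IsLocalRing A]
      (k : Type) [Field k] [Algebra k A], Function.Surjective (⇑(IsLocalRing.residue A) ∘ ⇑(algebraMap k A)) →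
      ∀ (t : A), t ≠ 0 → t ∈ maximalIdeal A → maximalIdeal A * Ideal.span {t} = ⊥ →
      ∀ (A₀ : AbelianSchemeOver (Spec (.of (A ⧸ Ideal.span {t})))), A₀.IsOfRelDim g →
        ∃ (X : AbelianSchemeOver (Spec (.of A))) (_ : X.IsOfRelDim g) (G : A₀.X.left ⟶ X.X.left),
          A₀.IsBaseChangeVia X (Spec.map (CommRingCat.ofHom (Ideal.Quotient.mk (Ideal.span {t})))) G := by
  intro A _ _ _ _ k _ _ hk t ht0 htm hmt A₀ hA₀
  -- the small-extension bookkeeping: `(t) ≠ ⊤`, `(t)² = 0`, the coefficient line, `A ⧸ (t)` Artin local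
  have hJ : Ideal.span {t} ≠ ⊤ := fun h =>
    mem_nonunits_iff.mp ((IsLocalRing.mem_maximalIdeal t).mp htm) (Ideal.span_singleton_eq_top.mp h)
  have hJJ : Ideal.span {t} * Ideal.span {t} = ⊥ :=
    eq_bot_iff.mpr ((Ideal.mul_mono_left (IsLocalRing.le_maximalIdeal hJ)).trans hmt.le)
  obtain ⟨eJ⟩ := nonempty_linearEquiv_span_singleton hk t ht0 hmt
  haveI : Nontrivial (A ⧸ Ideal.span {t}) := Ideal.Quotient.nontrivial_iff.mpr hJ
  haveI : IsLocalRing (A ⧸ Ideal.span {t}) := IsLocalRing.of_surjective' (Ideal.Quotient.mk _) Ideal.Quotient.mk_surjective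
  -- 2a′: the augmentation of `A ⧸ (t)`
  obtain ⟨π', -, hπ'nil, hπ'max⟩ := exists_quotient_augmentation_of_coefficientField hk hJ
  -- ★ 2bc (p797210 ∕ p797714, witnesses LITERAL): the closed fibre `A₀ ×_{A⧸(t)} k` + principal affine cover lifted from it
  obtain ⟨instΓ, halg, instΓA, halgA, ι, _, U', b', hb', hU'cov, -, U, hU, b, hb⟩ :=
    AbelianSchemeOver.exists_closedFibre_principal_affine_cover_explicit π' hπ'nil A₀
  exact abelianLift_of_closedFibre_cover hk hJ hmt hJJ eJ π' hπ'nil hπ'max A₀ hA₀ halg halgA U' b' hb' hU'cov U hU b hb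

end Summit.HodgeConjecture.HodgeConjecture.Cruxes.HDel.F11StubG1AbelianLift

end
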